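/-
Copyright (c) 2026 the pub-hodgecm-mathlib formalisation cell (harness21).  Prover seat hodgecm-mathlib-A-p19 (g28): road «S3-ram» (LEAD F0P3a-plan (g13); (Cnt2′) chair
F0P3a-p07 (g14) ruling (9)(b)), organ (z6) «FIX-FINITE, BLOCK LITERAL» for the type-(2) junction of F0P2-p02 (g14) — part 2, the interval and the finiteness; 2026-09-02.
-/
import Literature.NumberTheory.Automorphic.UnitaryLatticeTreeFixedFiniteModelTransport   -- ★ `finite_setOf_latticeGraphIso_eq_of_model`; brings ★ J4a `UnitaryLatticeTreeDiagonalFixedBounded`, ★ J4b `finite_of_forall_scaleLattice_le_and_le`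
import Literature.NumberTheory.Automorphic.UnitaryLatticeTreeBlockStableLattice            -- (this seat, part 1) `v_mul_sq_le_v_binaryForm`, `v_det_le_one_of_pairing_le_one`, `smul_line_mem_and_smul_plane_mem_of_map_endoShape_le`; brings ★ `UnitaryLatticeTreeAxisEndoFrame`
import HarnessLib

/-!
# The lattice graph of a hermitian space — a vertex stable under a BLOCK literal `ι(γ₂, u)` with `γ₂` ELLIPTIC (rootless) is squeezed between two fixed multiples of the
# root, so its fixed vertex set is finite (Kottwitz 1986 §3; Serre, *Trees* II.1.1; Bruhat–Tits 1972 §10; Weil, *Basic Number Theory* II §1)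

Topic `NumberTheory/Automorphic`; namespace `Literature.NumberTheory.Automorphic.UnitaryLatticeTree`.  THEOREMS ONLY (no definition, no instance, no notation, no named fact,
no `sorry`); kernel lane `--supports stmt-HodgeConjecture-24833`; datum-free (`K` with `Valued K ℤᵐ⁰`, `σ` valuation-preserving, `|2| = 1`, principal units are squares).
Cell `pub/hodgecm-mathlib` (D-0151), crux H413; road «S3-ram», (Cnt2′) route B «TYPE-(2) JUNCTION» (chair F0P3a-p07 (g14) rulings (8)–(9)): F0P2-p02 (g14)'s
`strataCount_J₀_block` (the five strata counts of a block literal in the `J₀`-model, sf 3925cecf) carries the binder `hFfin : {v ∣ latticeGraphIso σ ϖ J₀ γ v = v}.Finite`;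
for the type-(1) literals it is ★ J4a (`finite_setOf_latticeGraphIso_diagonal_eq`, a `K`-eigenframe argument) ∘ ★ `finite_setOf_latticeGraphIso_eq_of_model`.  A type-(2)
literal `ι(γ₂, u)` has NO `K`-eigenframe (`χ_{γ₂}` is rootless); THIS FILE is its supplier, for BOTH literals of the wave at once (the frame literal `ι(g_w, u_w)` on
`Φ₃ = ι-shape(Φ₂, 1)`, ★ `exists_vDeep_frameLiteral_frame_ram`, and the opposite literal `P·ι(γ₁, u_w)·P⁻¹`, `ᵗσ̄PJ₀P = ι-shape(diag d, η)`, ★ `exists_vDeep_oppositeLiteral_frame_ram`).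
HONEST LABEL: HC_CM is proved only modulo the 2 remaining named inputs (hLiu418 24832, h413 24833) until rung 0 closes; nothing printed is asserted here (elementary lattice algebra).

THE MATHEMATICS (form `H = ι-shape(H₂, h) = !![H₂₀₀, 0, H₂₀₁; 0, h, 0; H₂₁₀, 0, H₂₁₁]` with `H₂` integral, `|det H₂| = |h| = 1`; element `T = ι(a, u) = !![a₀₀, 0, a₀₁; 0, u, 0;
a₁₀, 0, a₁₁]` with `a ∈ M₂(𝒪)` ROOTLESS (`χ_a` has no root in `K`) and `|u| ≤ 1`; `Δ := χ_a(u) = u² − tr(a)u + det a ∈ 𝒪 ∖ {0}`).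
* Part 1 (★ `UnitaryLatticeTreeBlockStableLattice`, this seat): §1 coercivity `|4a²D|·max(|x|,|y|)² ≤ |Q(x,y)|` of an anisotropic integral binary form; §2 the Gram determinant
  of two `W`-vectors (integral pairings ⇒ `|det[b,b′]| ≤ 1`); §3 Cayley–Hamilton with the denominator kept (`Δx₁e₁, Δx_W ∈ M` for a `T`-stable `M ∋ x`).
* §4 the UPPER BOUND: for `M ≤ M^♯` and `x ∈ M`: `|Δx₁|²|h| ≤ 1`; and `b := Δx_W`, `b′ := Δ(Tx)_W ∈ M` have integral pairings, `det[b, b′] = Δ²·Q_a(x₀, x₂)` with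
  `Q_a(x, y) = det[(x,y), a(x,y)] = a₁₀x² + (a₁₁ − a₀₀)xy − a₀₁y²` of discriminant `tr(a)² − 4det(a)` — a NON-SQUARE because `a` is rootless and `|2| = 1` (and `a₁₀ ≠ 0` for the same
  reason): by §1 `M ≤ δ⁻¹L₀` with `δ = 4a₁₀²(tr² − 4det)·Δ²`.  ELLIPTICITY IS COERCIVITY: no appeal to the rank-2 tree of `W`.
* §5 the LOWER BOUND `ϖδL₀ ≤ M` for ANY integral unimodular `H` (J4a §3 verbatim with `|H_{ij}| ≤ 1` in place of diagonality).
* §6 `scaleLattice_le_and_le_of_isVertex_of_mapGL_endoShape_eq` (the interval), **`finite_setOf_latticeGraphIso_endoShape_eq`** ∕ **`…_endoGL_eq`** (block model, ★ J4b), and the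
  `J₀`-MODEL corollary **`finite_setOf_latticeGraphIso_antidiagonal_eq_of_coe_eq_conj_endoGL`** (`γ = P·ι(γ₂,u)·P⁻¹`, `ι-shape(H₂,h) = c • ᵗσ̄PJ₀P`; ★ `…_eq_of_model`) =
  the `hFfin` binder of `strataCount_J₀_block`.

## References
* [Kottwitz1986] R. E. Kottwitz, *Base change for unit elements of Hecke algebras*, Compositio Math. 60 (1986), §3 (fixed lattices of an elliptic element: finitely many).
* [Serre1980Trees] J.-P. Serre, *Trees* (1980), Ch. II §1.1.
* [BruhatTits1972] F. Bruhat, J. Tits, *Groupes réductifs sur un corps local I*, Publ. Math. IHÉS 41 (1972), §10.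
* [WeilBNT1967] A. Weil, *Basic Number Theory* (1967), Ch. II §1 Prop. 1 (anisotropic forms over local fields are coercive).
* [Jacobowitz1962] R. Jacobowitz, *Hermitian forms over local fields*, Amer. J. Math. 84 (1962), §4 (Gram determinants).
-/

set_option autoImplicit false

noncomputable section

open scoped Valued WithZero Matrix MatrixGroups

namespace Literature.NumberTheory.Automorphic.UnitaryLatticeTree

open Literature.NumberTheory.Automorphic Literature.NumberTheory.Automorphic.HermitianLattice Literature.NumberTheory.Rogawski1990

variable {K : Type*} [Field K] [Valued K ℤᵐ⁰]

/-! ## §4 The upper bound `M ≤ δ⁻¹·L₀` -/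

omit [Valued K ℤᵐ⁰] in
/-- The length of the line vector `t·e₁` for the `ι`-shaped form is `σ(t)·h·t`. [cite: Jacobowitz1962, §4] -/
theorem pairing_endoShapeForm_line_line (σ : K →+* K) (H₂ : Matrix (Fin 2) (Fin 2) K) (h t : K) :
    pairing σ (!![H₂ 0 0, 0, H₂ 0 1; 0, h, 0; H₂ 1 0, 0, H₂ 1 1] : Matrix (Fin 3) (Fin 3) K) ![0, t, 0] ![0, t, 0] = σ t * h * t := by
  simp [pairing_apply, Fin.sum_univ_three]

omit [Valued K ℤᵐ⁰] in
/-- A rootless `2 × 2` matrix has non-zero lower-left entry (else `e₀` is an eigenvector). [cite: Kottwitz1986, §3] -/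
theorem apply_one_zero_ne_zero_of_rootless {a : Matrix (Fin 2) (Fin 2) K} (hirr : ∀ t : K, t * t - (a 0 0 + a 1 1) * t + (a 0 0 * a 1 1 - a 0 1 * a 1 0) ≠ 0) :
    a 1 0 ≠ 0 := fun h0 => hirr (a 0 0) (by rw [h0]; ring)

omit [Valued K ℤᵐ⁰] in
/-- A rootless `2 × 2` matrix over a field with `2 ≠ 0` has NON-SQUARE discriminant `tr² − 4det = (a₁₁ − a₀₀)² + 4a₁₀a₀₁` (else `(tr + √D)∕2` is a root). [cite: Kottwitz1986, §3] -/
theorem not_isSquare_disc_of_rootless (h2 : (2 : K) ≠ 0) {a : Matrix (Fin 2) (Fin 2) K}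
    (hirr : ∀ t : K, t * t - (a 0 0 + a 1 1) * t + (a 0 0 * a 1 1 - a 0 1 * a 1 0) ≠ 0) :
    ¬ IsSquare ((a 1 1 - a 0 0) * (a 1 1 - a 0 0) - 4 * a 1 0 * (-(a 0 1))) := by
  rintro ⟨s, hs⟩
  apply hirr ((a 0 0 + a 1 1 + s) / 2)
  have h4 : (4 : K) ≠ 0 := by rw [show (4 : K) = 2 * 2 by norm_num]; exact mul_ne_zero h2 h2
  have e : (a 0 0 + a 1 1 + s) / 2 * ((a 0 0 + a 1 1 + s) / 2) - (a 0 0 + a 1 1) * ((a 0 0 + a 1 1 + s) / 2) + (a 0 0 * a 1 1 - a 0 1 * a 1 0) =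
      (s * s - ((a 1 1 - a 0 0) * (a 1 1 - a 0 0) - 4 * a 1 0 * (-(a 0 1)))) / 4 := by
    field_simp
    ring
  rw [e, ← hs, sub_self, zero_div]

/-- **THE UPPER BOUND** (`ι`-shaped integral data, `a` rootless, `|2| = 1`, principal units squares): if the `𝒪`-lattice `M` is stable under `T = ι(a, u)` and `M ≤ M^♯` for the
form `ι-shape(H₂, h)` (`|det H₂| = |h| = 1`), then every `x ∈ M` satisfies `|δ·xᵢ| ≤ 1` (`i = 0, 1, 2`) with the explicit
`δ = 4a₁₀²·((a₁₁ − a₀₀)² + 4a₁₀a₀₁)·χ_a(u)²` — §3 for the line, §2 + §1 (ellipticity as coercivity) for the plane. [cite: Kottwitz1986, §3] [cite: WeilBNT1967, Ch. II §1 Prop. 1] -/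
theorem v_mul_apply_le_one_of_map_endoShape_le_of_le_dualLatt {σ : K →+* K} (hvσ : ∀ a, Valued.v (σ a) = Valued.v a) (h2 : Valued.v (2 : K) = 1)
    (hsq : ∀ u : K, Valued.v (u - 1) < 1 → IsSquare u) {H₂ : Matrix (Fin 2) (Fin 2) K} (hH₂d : Valued.v H₂.det = 1) {h : K} (hh : Valued.v h = 1)
    {a : Matrix (Fin 2) (Fin 2) K} (ha : IsIntMatrix a) (hirr : ∀ t : K, t * t - (a 0 0 + a 1 1) * t + (a 0 0 * a 1 1 - a 0 1 * a 1 0) ≠ 0)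
    {u : K} (hu : Valued.v u ≤ 1) {M : Submodule 𝒪[K] (Fin 3 → K)}
    (hTM : M.map ((Matrix.toLin' (!![a 0 0, 0, a 0 1; 0, u, 0; a 1 0, 0, a 1 1] : Matrix (Fin 3) (Fin 3) K)).restrictScalars 𝒪[K]) ≤ M)
    (hMd : M ≤ dualLatt σ (!![H₂ 0 0, 0, H₂ 0 1; 0, h, 0; H₂ 1 0, 0, H₂ 1 1] : Matrix (Fin 3) (Fin 3) K) M) {x : Fin 3 → K} (hx : x ∈ M) (i : Fin 3) :
    Valued.v (4 * (a 1 0 * a 1 0) * ((a 1 1 - a 0 0) * (a 1 1 - a 0 0) - 4 * a 1 0 * (-(a 0 1))) *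
      ((u * u - (a 0 0 + a 1 1) * u + (a 0 0 * a 1 1 - a 0 1 * a 1 0)) * (u * u - (a 0 0 + a 1 1) * u + (a 0 0 * a 1 1 - a 0 1 * a 1 0))) * x i) ≤ 1 := by
  obtain ⟨Δ, hΔ⟩ : ∃ Δ : K, Δ = u * u - (a 0 0 + a 1 1) * u + (a 0 0 * a 1 1 - a 0 1 * a 1 0) := ⟨_, rfl⟩
  obtain ⟨D, hD⟩ : ∃ D : K, D = (a 1 1 - a 0 0) * (a 1 1 - a 0 0) - 4 * a 1 0 * (-(a 0 1)) := ⟨_, rfl⟩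
  rw [← hΔ, ← hD]
  have h20 : (2 : K) ≠ 0 := fun h0 => by rw [h0, map_zero] at h2; exact zero_ne_one h2
  have h4 : Valued.v (4 : K) = 1 := by rw [show (4 : K) = 2 * 2 by norm_num, map_mul, h2, one_mul]
  -- integrality of the constants
  have htr : Valued.v (a 0 0 + a 1 1) ≤ 1 := (Valuation.map_add _ _ _).trans (max_le (ha 0 0) (ha 1 1))
  have hdet : Valued.v (a 0 0 * a 1 1 - a 0 1 * a 1 0) ≤ 1 := by
    refine (Valuation.map_sub _ _ _).trans (max_le ?_ ?_)
    · rw [map_mul]; exact mul_le_one' (ha 0 0) (ha 1 1)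
    · rw [map_mul]; exact mul_le_one' (ha 0 1) (ha 1 0)
  have hΔ1 : Valued.v Δ ≤ 1 := by
    rw [hΔ]
    refine (Valuation.map_add _ _ _).trans (max_le ((Valuation.map_sub _ _ _).trans (max_le ?_ ?_)) hdet)
    · rw [map_mul]; exact mul_le_one' hu hu
    · rw [map_mul]; exact mul_le_one' htr hu
  have hA : Valued.v (a 1 0) ≤ 1 := ha 1 0
  have hB : Valued.v (a 1 1 - a 0 0) ≤ 1 := (Valuation.map_sub _ _ _).trans (max_le (ha 1 1) (ha 0 0))
  have hC : Valued.v (-(a 0 1)) ≤ 1 := by rw [Valuation.map_neg]; exact ha 0 1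
  have hD1 : Valued.v D ≤ 1 := by
    rw [hD]
    refine (Valuation.map_sub _ _ _).trans (max_le ?_ ?_)
    · rw [map_mul]; exact mul_le_one' hB hB
    · rw [map_mul, map_mul, h4, one_mul]; exact mul_le_one' hA hC
  have hc₀1 : Valued.v (4 * (a 1 0 * a 1 0) * D) ≤ 1 := by
    rw [map_mul, map_mul, h4, one_mul, map_mul]; exact mul_le_one' (mul_le_one' hA hA) hD1
  have hDns : ¬ IsSquare D := by rw [hD]; exact not_isSquare_disc_of_rootless h20 hirr
  -- the members of `M` from §3
  have hpair : ∀ y ∈ M, ∀ z ∈ M, Valued.v (pairing σ (!![H₂ 0 0, 0, H₂ 0 1; 0, h, 0; H₂ 1 0, 0, H₂ 1 1] : Matrix (Fin 3) (Fin 3) K) y z) ≤ 1 :=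
    fun y hy z hz => (mem_dualLatt _ _ _ _).1 (hMd hz) y hy
  obtain ⟨hl, hW⟩ := smul_line_mem_and_smul_plane_mem_of_map_endoShape_le ha hu hTM hx
  rw [← hΔ] at hl hW
  have hTx : (![a 0 0 * x 0 + a 0 1 * x 2, u * x 1, a 1 0 * x 0 + a 1 1 * x 2] : Fin 3 → K) ∈ M := by
    have h := hTM (Submodule.mem_map.2 ⟨x, hx, rfl⟩)
    rw [LinearMap.restrictScalars_apply, Matrix.toLin'_apply, endoShape_mulVec_eq] at h
    exact h
  obtain ⟨-, hW'⟩ := smul_line_mem_and_smul_plane_mem_of_map_endoShape_le ha hu hTM hTx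
  rw [← hΔ] at hW'
  have e' : (![Δ * (![a 0 0 * x 0 + a 0 1 * x 2, u * x 1, a 1 0 * x 0 + a 1 1 * x 2] : Fin 3 → K) 0, 0,
      Δ * (![a 0 0 * x 0 + a 0 1 * x 2, u * x 1, a 1 0 * x 0 + a 1 1 * x 2] : Fin 3 → K) 2] : Fin 3 → K) =
      ![Δ * (a 0 0 * x 0 + a 0 1 * x 2), 0, Δ * (a 1 0 * x 0 + a 1 1 * x 2)] := by simp
  rw [e'] at hW'
  -- the line coordinate: `|Δ x₁| ≤ 1`
  have hline1 : Valued.v (Δ * x 1) ≤ 1 := by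
    have hp := hpair _ hl _ hl
    rw [pairing_endoShapeForm_line_line, map_mul, map_mul, hvσ, hh, mul_one] at hp
    by_contra hne
    exact absurd hp (not_le.2 (lt_of_lt_of_le (not_le.1 hne) (le_mul_of_one_le_right' (not_le.1 hne).le)))
  -- the plane coordinates: `|Δ² Q_a(x₀, x₂)| ≤ 1` by the Gram determinant, then coercivity
  have hdetb := v_det_le_one_of_pairing_le_one hvσ hH₂d h (b := ![Δ * x 0, 0, Δ * x 2]) (b' := ![Δ * (a 0 0 * x 0 + a 0 1 * x 2), 0, Δ * (a 1 0 * x 0 + a 1 1 * x 2)])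
    (by simp) (by simp) (hpair _ hW _ hW) (hpair _ hW' _ hW') (hpair _ hW _ hW') (hpair _ hW' _ hW)
  obtain ⟨Q, hQdef⟩ : ∃ Q : K, Q = a 1 0 * (x 0 * x 0) + (a 1 1 - a 0 0) * (x 0 * x 2) + -(a 0 1) * (x 2 * x 2) := ⟨_, rfl⟩
  have hQ' : Valued.v (Δ * Δ * Q) ≤ 1 := by
    have e : (![Δ * x 0, 0, Δ * x 2] : Fin 3 → K) 0 * (![Δ * (a 0 0 * x 0 + a 0 1 * x 2), 0, Δ * (a 1 0 * x 0 + a 1 1 * x 2)] : Fin 3 → K) 2 -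
        (![Δ * x 0, 0, Δ * x 2] : Fin 3 → K) 2 * (![Δ * (a 0 0 * x 0 + a 0 1 * x 2), 0, Δ * (a 1 0 * x 0 + a 1 1 * x 2)] : Fin 3 → K) 0 =
        Δ * Δ * Q := by
      rw [hQdef]; simp; ring
    rw [e] at hdetb
    exact hdetb
  obtain ⟨C, hCdef⟩ : ∃ C : K, C = 4 * (a 1 0 * a 1 0) * D := ⟨_, rfl⟩
  have hC1 : Valued.v C ≤ 1 := by rw [hCdef]; exact hc₀1
  have hDeq : (a 1 1 - a 0 0) * (a 1 1 - a 0 0) - 4 * a 1 0 * (-(a 0 1)) = D := hD.symm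
  obtain ⟨hcx, hcy⟩ := v_mul_sq_le_v_binaryForm h2 hsq hA hB hC (by rw [hDeq]; exact hDns) (x 0) (x 2)
  rw [hDeq, ← hCdef, ← hQdef] at hcx hcy
  rw [← hCdef]
  fin_cases i
  · show Valued.v (C * (Δ * Δ) * x 0) ≤ 1
    by_contra hne
    refine absurd ?_ (not_le.2 (lt_of_lt_of_le (not_le.1 hne) (le_mul_of_one_le_right' (not_le.1 hne).le)))
    rw [← Valuation.map_mul, show C * (Δ * Δ) * x 0 * (C * (Δ * Δ) * x 0) = (C * (Δ * Δ)) * ((C * (x 0 * x 0)) * (Δ * Δ)) by ring,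
      Valuation.map_mul _ (C * (Δ * Δ)) (C * (x 0 * x 0) * (Δ * Δ))]
    refine mul_le_one' ?_ ?_
    · rw [Valuation.map_mul _ C (Δ * Δ), Valuation.map_mul _ Δ Δ]; exact mul_le_one' hC1 (mul_le_one' hΔ1 hΔ1)
    · rw [Valuation.map_mul _ (C * (x 0 * x 0)) (Δ * Δ)]
      calc Valued.v (C * (x 0 * x 0)) * Valued.v (Δ * Δ) ≤ Valued.v Q * Valued.v (Δ * Δ) := by
            refine mul_le_mul' ?_ le_rfl
            rw [Valuation.map_mul _ C (x 0 * x 0), Valuation.map_mul _ (x 0) (x 0)]; exact hcx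
        _ = Valued.v (Δ * Δ * Q) := by rw [← Valuation.map_mul, mul_comm]
        _ ≤ 1 := hQ'
  · show Valued.v (C * (Δ * Δ) * x 1) ≤ 1
    rw [show C * (Δ * Δ) * x 1 = (C * Δ) * (Δ * x 1) by ring, Valuation.map_mul _ (C * Δ) (Δ * x 1), Valuation.map_mul _ C Δ]
    exact mul_le_one' (mul_le_one' hC1 hΔ1) hline1
  · show Valued.v (C * (Δ * Δ) * x 2) ≤ 1
    by_contra hne
    refine absurd ?_ (not_le.2 (lt_of_lt_of_le (not_le.1 hne) (le_mul_of_one_le_right' (not_le.1 hne).le)))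
    rw [← Valuation.map_mul, show C * (Δ * Δ) * x 2 * (C * (Δ * Δ) * x 2) = (C * (Δ * Δ)) * ((C * (x 2 * x 2)) * (Δ * Δ)) by ring,
      Valuation.map_mul _ (C * (Δ * Δ)) (C * (x 2 * x 2) * (Δ * Δ))]
    refine mul_le_one' ?_ ?_
    · rw [Valuation.map_mul _ C (Δ * Δ), Valuation.map_mul _ Δ Δ]; exact mul_le_one' hC1 (mul_le_one' hΔ1 hΔ1)
    · rw [Valuation.map_mul _ (C * (x 2 * x 2)) (Δ * Δ)]
      calc Valued.v (C * (x 2 * x 2)) * Valued.v (Δ * Δ) ≤ Valued.v Q * Valued.v (Δ * Δ) := by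
            refine mul_le_mul' ?_ le_rfl
            rw [Valuation.map_mul _ C (x 2 * x 2), Valuation.map_mul _ (x 2) (x 2)]; exact hcy
        _ = Valued.v (Δ * Δ * Q) := by rw [← Valuation.map_mul, mul_comm]
        _ ≤ 1 := hQ'

/-! ## §5 The lower bound `ϖδ·L₀ ≤ M` for an integral unimodular form -/

/-- **`δ·L₀ ≤ (δ⁻¹·L₀)^♯ ≤ M^♯`** for ANY integral form `H`: if `M ≤ δ⁻¹·L₀` then every `y` with `|yᵢ| ≤ |δ|` pairs integrally with `M` (`|⟨x, y⟩| ≤ maxᵢⱼ |xᵢ|·|Hᵢⱼ|·|yⱼ| ≤ 1`;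
J4a's `scaleLattice_le_dualLatt_of_le_scaleLattice_inv` is the diagonal case). [cite: Jacobowitz1962, §4] [cite: Kottwitz1986, §3] -/
theorem scaleLattice_le_dualLatt_of_le_scaleLattice_inv_of_isIntMatrix {N : ℕ} {σ : K →+* K} (hvσ : ∀ a, Valued.v (σ a) = Valued.v a)
    {H : Matrix (Fin N) (Fin N) K} (hH : IsIntMatrix H) {δ : K} (hδ0 : δ ≠ 0) {M : Submodule 𝒪[K] (Fin N → K)} (hM : M ≤ scaleLattice δ⁻¹ (stdLattice K N)) :
    scaleLattice δ (stdLattice K N) ≤ dualLatt σ H M := by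
  intro y hy
  rw [mem_dualLatt]
  intro x hx
  have hxi : ∀ i, Valued.v (x i) ≤ Valued.v δ⁻¹ := (mem_scaleLattice_stdLattice_iff (inv_ne_zero hδ0) x).1 (hM hx)
  have hyi : ∀ i, Valued.v (y i) ≤ Valued.v δ := (mem_scaleLattice_stdLattice_iff hδ0 y).1 hy
  have hvδ : Valued.v δ ≠ 0 := (Valuation.ne_zero_iff _).2 hδ0
  rw [pairing_apply]
  refine Valuation.map_sum_le _ (fun i _ => Valuation.map_sum_le _ (fun j _ => ?_))
  rw [map_mul, map_mul, hvσ]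
  calc Valued.v (x i) * Valued.v (H i j) * Valued.v (y j) ≤ Valued.v δ⁻¹ * 1 * Valued.v δ := mul_le_mul' (mul_le_mul' (hxi i) (hH i j)) (hyi j)
    _ = 1 := by rw [mul_one, map_inv₀, inv_mul_cancel₀ hvδ]

/-- **THE LOWER BOUND**: for a VERTEX lattice `M` of an integral unimodular form `H` (so `ϖ·M^♯ ≤ M`) with `M ≤ δ⁻¹·L₀`: `ϖδ·L₀ ≤ M`. [cite: Kottwitz1986, §3] [cite: BruhatTits1972, §10] -/
theorem scaleLattice_mul_le_of_isVertexLattice_of_le_scaleLattice_inv_of_isIntMatrix {N : ℕ} {σ : K →+* K} (hvσ : ∀ a, Valued.v (σ a) = Valued.v a) {ϖ : K}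
    {H : Matrix (Fin N) (Fin N) K} (hH : IsIntMatrix H) (hHu : IsUnit H.det) {δ : K} (hδ0 : δ ≠ 0) {dd : ℕ} {M : Submodule 𝒪[K] (Fin N → K)}
    (hMv : IsVertexLattice σ ϖ H dd M) (hM : M ≤ scaleLattice δ⁻¹ (stdLattice K N)) :
    scaleLattice (ϖ * δ) (stdLattice K N) ≤ M := by
  calc scaleLattice (ϖ * δ) (stdLattice K N) = scaleLattice ϖ (scaleLattice δ (stdLattice K N)) := (scaleLattice_scaleLattice ϖ δ _).symm
    _ ≤ scaleLattice ϖ (dualLatt σ H M) := scaleLattice_mono ϖ (scaleLattice_le_dualLatt_of_le_scaleLattice_inv_of_isIntMatrix hvσ hH hδ0 hM)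
    _ ≤ M := scaleLattice_dualLatt_le_of_isVertexLattice hvσ hHu hMv

/-! ## §6 The interval and the finiteness of the fixed vertex set of a block literal -/

/-- **A VERTEX FIXED BY AN ELLIPTIC BLOCK LITERAL IS DEPTH-BOUNDED**: for the `ι`-shaped form `H = ι-shape(H₂, h)` (`H₂` integral, `|det H₂| = |h| = 1`) and `T ∈ GL₃(K)` with
`↑T = ι(a, u)` (`a` integral ROOTLESS, `|u| ≤ 1`; `|2| = 1`, principal units squares), every VERTEX `M` of `latticeGraph σ ϖ H` with `T·M = M` satisfies
`ϖδ·L₀ ≤ M ≤ δ⁻¹·L₀` for the explicit non-zero `δ = 4a₁₀²((a₁₁ − a₀₀)² + 4a₁₀a₀₁)·χ_a(u)²`. [cite: Kottwitz1986, §3] [cite: Serre1980Trees, II.1.1] [cite: BruhatTits1972, §10] -/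
theorem scaleLattice_le_and_le_of_isVertex_of_mapGL_endoShape_eq {σ : K →+* K} (hvσ : ∀ a, Valued.v (σ a) = Valued.v a) (h2 : Valued.v (2 : K) = 1)
    (hsq : ∀ u : K, Valued.v (u - 1) < 1 → IsSquare u) {ϖ : K} {H₂ : Matrix (Fin 2) (Fin 2) K} (hH₂i : IsIntMatrix H₂) (hH₂d : Valued.v H₂.det = 1)
    {h : K} (hh : Valued.v h = 1) {a : Matrix (Fin 2) (Fin 2) K} (ha : IsIntMatrix a)
    (hirr : ∀ t : K, t * t - (a 0 0 + a 1 1) * t + (a 0 0 * a 1 1 - a 0 1 * a 1 0) ≠ 0) {u : K} (hu : Valued.v u ≤ 1)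
    (T : GL (Fin 3) K) (hT : (T : Matrix (Fin 3) (Fin 3) K) = !![a 0 0, 0, a 0 1; 0, u, 0; a 1 0, 0, a 1 1])
    {M : Submodule 𝒪[K] (Fin 3 → K)} (hM : IsVertex σ ϖ (!![H₂ 0 0, 0, H₂ 0 1; 0, h, 0; H₂ 1 0, 0, H₂ 1 1] : Matrix (Fin 3) (Fin 3) K) M)
    (hfix : mapGL T M = M) :
    scaleLattice (ϖ * (4 * (a 1 0 * a 1 0) * ((a 1 1 - a 0 0) * (a 1 1 - a 0 0) - 4 * a 1 0 * (-(a 0 1))) *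
        ((u * u - (a 0 0 + a 1 1) * u + (a 0 0 * a 1 1 - a 0 1 * a 1 0)) * (u * u - (a 0 0 + a 1 1) * u + (a 0 0 * a 1 1 - a 0 1 * a 1 0))))) (stdLattice K 3) ≤ M ∧
      M ≤ scaleLattice (4 * (a 1 0 * a 1 0) * ((a 1 1 - a 0 0) * (a 1 1 - a 0 0) - 4 * a 1 0 * (-(a 0 1))) *
        ((u * u - (a 0 0 + a 1 1) * u + (a 0 0 * a 1 1 - a 0 1 * a 1 0)) * (u * u - (a 0 0 + a 1 1) * u + (a 0 0 * a 1 1 - a 0 1 * a 1 0))))⁻¹ (stdLattice K 3) := by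
  obtain ⟨dd, hMv⟩ := hM
  have h20 : (2 : K) ≠ 0 := fun h0 => by rw [h0, map_zero] at h2; exact zero_ne_one h2
  -- `δ ≠ 0`
  have hδ0 : 4 * (a 1 0 * a 1 0) * ((a 1 1 - a 0 0) * (a 1 1 - a 0 0) - 4 * a 1 0 * (-(a 0 1))) *
      ((u * u - (a 0 0 + a 1 1) * u + (a 0 0 * a 1 1 - a 0 1 * a 1 0)) * (u * u - (a 0 0 + a 1 1) * u + (a 0 0 * a 1 1 - a 0 1 * a 1 0))) ≠ 0 := by
    have hA0 := apply_one_zero_ne_zero_of_rootless hirr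
    have hD0 : (a 1 1 - a 0 0) * (a 1 1 - a 0 0) - 4 * a 1 0 * (-(a 0 1)) ≠ 0 := fun h0 =>
      not_isSquare_disc_of_rootless h20 hirr ⟨0, by rw [h0, mul_zero]⟩
    have h4 : (4 : K) ≠ 0 := by rw [show (4 : K) = 2 * 2 by norm_num]; exact mul_ne_zero h20 h20
    exact mul_ne_zero (mul_ne_zero (mul_ne_zero h4 (mul_ne_zero hA0 hA0)) hD0) (mul_ne_zero (hirr u) (hirr u))
  have hSM : M.map ((Matrix.toLin' (!![a 0 0, 0, a 0 1; 0, u, 0; a 1 0, 0, a 1 1] : Matrix (Fin 3) (Fin 3) K)).restrictScalars 𝒪[K]) ≤ M := by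
    rw [← hT]; exact hfix.le
  have hup : M ≤ scaleLattice (4 * (a 1 0 * a 1 0) * ((a 1 1 - a 0 0) * (a 1 1 - a 0 0) - 4 * a 1 0 * (-(a 0 1))) *
      ((u * u - (a 0 0 + a 1 1) * u + (a 0 0 * a 1 1 - a 0 1 * a 1 0)) * (u * u - (a 0 0 + a 1 1) * u + (a 0 0 * a 1 1 - a 0 1 * a 1 0))))⁻¹ (stdLattice K 3) := by
    intro x hx
    rw [mem_scaleLattice_stdLattice_iff (inv_ne_zero hδ0)]
    intro i
    have hle := v_mul_apply_le_one_of_map_endoShape_le_of_le_dualLatt hvσ h2 hsq hH₂d hh ha hirr hu hSM (le_dualLatt_of_isVertexLattice hvσ hMv) hx i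
    rw [map_mul] at hle
    rw [map_inv₀]
    have hvδ : Valued.v (4 * (a 1 0 * a 1 0) * ((a 1 1 - a 0 0) * (a 1 1 - a 0 0) - 4 * a 1 0 * (-(a 0 1))) *
        ((u * u - (a 0 0 + a 1 1) * u + (a 0 0 * a 1 1 - a 0 1 * a 1 0)) * (u * u - (a 0 0 + a 1 1) * u + (a 0 0 * a 1 1 - a 0 1 * a 1 0)))) ≠ 0 :=
      (Valuation.ne_zero_iff _).2 hδ0
    calc Valued.v (x i) = (Valued.v (4 * (a 1 0 * a 1 0) * ((a 1 1 - a 0 0) * (a 1 1 - a 0 0) - 4 * a 1 0 * (-(a 0 1))) *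
          ((u * u - (a 0 0 + a 1 1) * u + (a 0 0 * a 1 1 - a 0 1 * a 1 0)) * (u * u - (a 0 0 + a 1 1) * u + (a 0 0 * a 1 1 - a 0 1 * a 1 0)))))⁻¹ *
          (Valued.v (4 * (a 1 0 * a 1 0) * ((a 1 1 - a 0 0) * (a 1 1 - a 0 0) - 4 * a 1 0 * (-(a 0 1))) *
            ((u * u - (a 0 0 + a 1 1) * u + (a 0 0 * a 1 1 - a 0 1 * a 1 0)) * (u * u - (a 0 0 + a 1 1) * u + (a 0 0 * a 1 1 - a 0 1 * a 1 0)))) * Valued.v (x i)) := by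
            rw [← mul_assoc, inv_mul_cancel₀ hvδ, one_mul]
      _ ≤ _ * 1 := mul_le_mul' le_rfl hle
      _ = _ := mul_one _
  have hHi : IsIntMatrix (!![H₂ 0 0, 0, H₂ 0 1; 0, h, 0; H₂ 1 0, 0, H₂ 1 1] : Matrix (Fin 3) (Fin 3) K) := by
    intro i j
    fin_cases i <;> fin_cases j <;> simp [hh.le, hH₂i 0 0, hH₂i 0 1, hH₂i 1 0, hH₂i 1 1]
  have hHu : IsUnit (!![H₂ 0 0, 0, H₂ 0 1; 0, h, 0; H₂ 1 0, 0, H₂ 1 1] : Matrix (Fin 3) (Fin 3) K).det := by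
    rw [det_endoShape, isUnit_iff_ne_zero]
    intro h0
    have hv : Valued.v (H₂.det * h) = 1 := by rw [map_mul, hH₂d, hh, one_mul]
    rw [h0, map_zero] at hv
    exact zero_ne_one hv
  exact ⟨scaleLattice_mul_le_of_isVertexLattice_of_le_scaleLattice_inv_of_isIntMatrix hvσ hHi hHu hδ0 hMv hup, hup⟩

/-- **THE FIXED VERTEX SET OF AN ELLIPTIC BLOCK LITERAL IS FINITE** (finite residue field; block model): for `Γ ∈ U(σ, ι-shape(H₂, h))` with `↑Γ = ι(a, u)`, `a` integral
rootless, `|u| ≤ 1`, the vertices of `latticeGraph σ ϖ ι-shape(H₂, h)` fixed by `latticeGraphIso Γ` form a FINITE set (the interval of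
`scaleLattice_le_and_le_of_isVertex_of_mapGL_endoShape_eq` is finite by ★ J4b). [cite: Kottwitz1986, §3] [cite: Serre1980Trees, II.1.1] [cite: BruhatTits1972, §10] -/
theorem finite_setOf_latticeGraphIso_endoShape_eq [Finite 𝓀[K]] {σ : K →+* K} (hvσ : ∀ a, Valued.v (σ a) = Valued.v a) (h2 : Valued.v (2 : K) = 1)
    (hsq : ∀ u : K, Valued.v (u - 1) < 1 → IsSquare u) {ϖ : K} (hϖ : Valued.v ϖ = WithZero.exp (-1 : ℤ))
    {H₂ : Matrix (Fin 2) (Fin 2) K} (hH₂i : IsIntMatrix H₂) (hH₂d : Valued.v H₂.det = 1) {h : K} (hh : Valued.v h = 1)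
    {a : Matrix (Fin 2) (Fin 2) K} (ha : IsIntMatrix a) (hirr : ∀ t : K, t * t - (a 0 0 + a 1 1) * t + (a 0 0 * a 1 1 - a 0 1 * a 1 0) ≠ 0)
    {u : K} (hu : Valued.v u ≤ 1)
    (Γ : unitaryGroupOfForm σ (!![H₂ 0 0, 0, H₂ 0 1; 0, h, 0; H₂ 1 0, 0, H₂ 1 1] : Matrix (Fin 3) (Fin 3) K))
    (hΓ : ((Γ : GL (Fin 3) K) : Matrix (Fin 3) (Fin 3) K) = !![a 0 0, 0, a 0 1; 0, u, 0; a 1 0, 0, a 1 1]) :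
    {v : {M : Submodule 𝒪[K] (Fin 3 → K) // IsVertex σ ϖ (!![H₂ 0 0, 0, H₂ 0 1; 0, h, 0; H₂ 1 0, 0, H₂ 1 1] : Matrix (Fin 3) (Fin 3) K) M} |
      latticeGraphIso σ ϖ (!![H₂ 0 0, 0, H₂ 0 1; 0, h, 0; H₂ 1 0, 0, H₂ 1 1] : Matrix (Fin 3) (Fin 3) K) Γ v = v}.Finite := by
  have hϖ0 : ϖ ≠ 0 := by
    intro h0; rw [h0, map_zero] at hϖ; exact WithZero.coe_ne_zero hϖ.symm
  have hϖ1 : Valued.v ϖ ≤ 1 := by rw [hϖ, ← WithZero.exp_zero]; exact WithZero.exp_le_exp.2 (by norm_num)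
  obtain ⟨δ, hδ⟩ : ∃ δ : K, δ = 4 * (a 1 0 * a 1 0) * ((a 1 1 - a 0 0) * (a 1 1 - a 0 0) - 4 * a 1 0 * (-(a 0 1))) *
      ((u * u - (a 0 0 + a 1 1) * u + (a 0 0 * a 1 1 - a 0 1 * a 1 0)) * (u * u - (a 0 0 + a 1 1) * u + (a 0 0 * a 1 1 - a 0 1 * a 1 0))) := ⟨_, rfl⟩
  have h20 : (2 : K) ≠ 0 := fun h0 => by rw [h0, map_zero] at h2; exact zero_ne_one h2
  have h4 : Valued.v (4 : K) = 1 := by rw [show (4 : K) = 2 * 2 by norm_num, map_mul, h2, one_mul]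
  have hδ0 : δ ≠ 0 := by
    have hA0 := apply_one_zero_ne_zero_of_rootless hirr
    have hD0 : (a 1 1 - a 0 0) * (a 1 1 - a 0 0) - 4 * a 1 0 * (-(a 0 1)) ≠ 0 := fun h0 =>
      not_isSquare_disc_of_rootless h20 hirr ⟨0, by rw [h0, mul_zero]⟩
    have h4' : (4 : K) ≠ 0 := by rw [show (4 : K) = 2 * 2 by norm_num]; exact mul_ne_zero h20 h20
    rw [hδ]
    exact mul_ne_zero (mul_ne_zero (mul_ne_zero h4' (mul_ne_zero hA0 hA0)) hD0) (mul_ne_zero (hirr u) (hirr u))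
  -- `|δ| ≤ 1`, hence `|ϖδ| ≤ |δ⁻¹|`
  have hδ1 : Valued.v δ ≤ 1 := by
    have htr : Valued.v (a 0 0 + a 1 1) ≤ 1 := (Valuation.map_add _ _ _).trans (max_le (ha 0 0) (ha 1 1))
    have hdet : Valued.v (a 0 0 * a 1 1 - a 0 1 * a 1 0) ≤ 1 := by
      refine (Valuation.map_sub _ _ _).trans (max_le ?_ ?_)
      · rw [map_mul]; exact mul_le_one' (ha 0 0) (ha 1 1)
      · rw [map_mul]; exact mul_le_one' (ha 0 1) (ha 1 0)
    have hΔ1 : Valued.v (u * u - (a 0 0 + a 1 1) * u + (a 0 0 * a 1 1 - a 0 1 * a 1 0)) ≤ 1 := by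
      refine (Valuation.map_add _ _ _).trans (max_le ((Valuation.map_sub _ _ _).trans (max_le ?_ ?_)) hdet)
      · rw [map_mul]; exact mul_le_one' hu hu
      · rw [map_mul]; exact mul_le_one' htr hu
    have hB : Valued.v (a 1 1 - a 0 0) ≤ 1 := (Valuation.map_sub _ _ _).trans (max_le (ha 1 1) (ha 0 0))
    have hD1 : Valued.v ((a 1 1 - a 0 0) * (a 1 1 - a 0 0) - 4 * a 1 0 * (-(a 0 1))) ≤ 1 := by
      refine (Valuation.map_sub _ _ _).trans (max_le ?_ ?_)
      · rw [map_mul]; exact mul_le_one' hB hB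
      · rw [map_mul, map_mul, h4, one_mul, Valuation.map_neg]; exact mul_le_one' (ha 1 0) (ha 0 1)
    rw [hδ, map_mul, map_mul, map_mul, h4, one_mul, map_mul, map_mul]
    exact mul_le_one' (mul_le_one' (mul_le_one' (ha 1 0) (ha 1 0)) hD1) (mul_le_one' hΔ1 hΔ1)
  have hab : Valued.v (ϖ * δ) ≤ Valued.v δ⁻¹ := by
    rw [map_mul, map_inv₀]
    calc Valued.v ϖ * Valued.v δ ≤ 1 * 1 := mul_le_mul' hϖ1 hδ1
      _ = 1 := one_mul 1
      _ ≤ (Valued.v δ)⁻¹ := one_le_inv_iff₀.2 ⟨(Valuation.pos_iff _).2 hδ0, hδ1⟩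
  have himage : (Subtype.val '' {v : {M : Submodule 𝒪[K] (Fin 3 → K) // IsVertex σ ϖ (!![H₂ 0 0, 0, H₂ 0 1; 0, h, 0; H₂ 1 0, 0, H₂ 1 1] : Matrix (Fin 3) (Fin 3) K) M} |
      latticeGraphIso σ ϖ (!![H₂ 0 0, 0, H₂ 0 1; 0, h, 0; H₂ 1 0, 0, H₂ 1 1] : Matrix (Fin 3) (Fin 3) K) Γ v = v}).Finite := by
    refine finite_of_forall_scaleLattice_le_and_le hϖ (mul_ne_zero hϖ0 hδ0) hab (fun M hM => ?_)
    obtain ⟨v, hv, rfl⟩ := hM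
    have hfix : mapGL (Γ : GL (Fin 3) K) v.1 = v.1 := congrArg Subtype.val hv
    rw [hδ]
    exact scaleLattice_le_and_le_of_isVertex_of_mapGL_endoShape_eq hvσ h2 hsq hH₂i hH₂d hh ha hirr hu (Γ : GL (Fin 3) K) hΓ v.2 hfix
  exact Set.Finite.of_finite_image himage Subtype.val_injective.injOn

/-- **THE FIXED VERTEX SET OF `endoGL(γ₂, u)` IS FINITE** for `γ₂ ∈ GL₂(K)` integral with ROOTLESS characteristic polynomial and `u ∈ GL₁(K)` integral (block model) —
`finite_setOf_latticeGraphIso_endoShape_eq` in the `endoGL` spelling of ★ `EndoscopicEmbedding` (`Matrix.charpoly_fin_two`). [cite: Kottwitz1986, §3] [cite: Rogawski1990, §4.9 p. 55] -/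
theorem finite_setOf_latticeGraphIso_endoGL_eq_of_rootless [Finite 𝓀[K]] {σ : K →+* K} (hvσ : ∀ a, Valued.v (σ a) = Valued.v a) (h2 : Valued.v (2 : K) = 1)
    (hsq : ∀ u : K, Valued.v (u - 1) < 1 → IsSquare u) {ϖ : K} (hϖ : Valued.v ϖ = WithZero.exp (-1 : ℤ))
    {H₂ : Matrix (Fin 2) (Fin 2) K} (hH₂i : IsIntMatrix H₂) (hH₂d : Valued.v H₂.det = 1) {h : K} (hh : Valued.v h = 1)
    (γ₂ : GL (Fin 2) K) (hγ : IsIntMatrix (γ₂ : Matrix (Fin 2) (Fin 2) K)) (hirr : ∀ x : K, ¬ (γ₂ : Matrix (Fin 2) (Fin 2) K).charpoly.IsRoot x)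
    (u : GL (Fin 1) K) (hu : Valued.v ((u : Matrix (Fin 1) (Fin 1) K) 0 0) ≤ 1)
    (Γ : unitaryGroupOfForm σ (!![H₂ 0 0, 0, H₂ 0 1; 0, h, 0; H₂ 1 0, 0, H₂ 1 1] : Matrix (Fin 3) (Fin 3) K))
    (hΓ : (Γ : GL (Fin 3) K) = endoGL (γ₂, u)) :
    {v : {M : Submodule 𝒪[K] (Fin 3 → K) // IsVertex σ ϖ (!![H₂ 0 0, 0, H₂ 0 1; 0, h, 0; H₂ 1 0, 0, H₂ 1 1] : Matrix (Fin 3) (Fin 3) K) M} |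
      latticeGraphIso σ ϖ (!![H₂ 0 0, 0, H₂ 0 1; 0, h, 0; H₂ 1 0, 0, H₂ 1 1] : Matrix (Fin 3) (Fin 3) K) Γ v = v}.Finite := by
  have hnt : Nontrivial K := inferInstance
  have hirr' : ∀ t : K, t * t - ((γ₂ : Matrix (Fin 2) (Fin 2) K) 0 0 + (γ₂ : Matrix (Fin 2) (Fin 2) K) 1 1) * t +
      ((γ₂ : Matrix (Fin 2) (Fin 2) K) 0 0 * (γ₂ : Matrix (Fin 2) (Fin 2) K) 1 1 - (γ₂ : Matrix (Fin 2) (Fin 2) K) 0 1 * (γ₂ : Matrix (Fin 2) (Fin 2) K) 1 0) ≠ 0 := by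
    intro t ht
    apply hirr t
    rw [Polynomial.IsRoot, Matrix.charpoly_fin_two, Matrix.trace_fin_two, Matrix.det_fin_two]
    simp only [Polynomial.eval_add, Polynomial.eval_sub, Polynomial.eval_pow, Polynomial.eval_X, Polynomial.eval_mul, Polynomial.eval_C]
    rw [← ht]; ring
  have hΓ' : ((Γ : GL (Fin 3) K) : Matrix (Fin 3) (Fin 3) K) =
      !![(γ₂ : Matrix (Fin 2) (Fin 2) K) 0 0, 0, (γ₂ : Matrix (Fin 2) (Fin 2) K) 0 1; 0, (u : Matrix (Fin 1) (Fin 1) K) 0 0, 0;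
        (γ₂ : Matrix (Fin 2) (Fin 2) K) 1 0, 0, (γ₂ : Matrix (Fin 2) (Fin 2) K) 1 1] := by
    rw [hΓ]; exact coe_endoGL_eq_endoShape γ₂ u
  exact finite_setOf_latticeGraphIso_endoShape_eq hvσ h2 hsq hϖ hH₂i hH₂d hh hγ hirr' hu Γ hΓ'

/-- **`Fix(γ)` IS FINITE IN THE `J₀`-MODEL FOR A CONJUGATED BLOCK LITERAL** `γ ∈ U(σ, J₀)`, `↑γ = P·endoGL(γ₂, u)·P⁻¹`, where the frame `P` carries `J₀` to a multiple of the
`ι`-shaped form: `ι-shape(H₂, h) = c • ᵗσ̄P·J₀·P` (`|c| = 1`).  This is the `hFfin` binder of the type-(2) junction `strataCount_J₀_block` for BOTH literals of the wave: the frame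
literal (`P = 1`, `H₂ = Φ₂`, `h = 1`) and the opposite literal (`P` of ★ `exists_vDeep_oppositeLiteral_frame_ram`, `H₂ = diag d`, `h = η`).  (★ `finite_setOf_latticeGraphIso_eq_of_model`
over `finite_setOf_latticeGraphIso_endoGL_eq_of_rootless`.) [cite: Kottwitz1986, §3] [cite: Rogawski1990, §4.9 p. 55] [cite: BruhatTits1972, §10] -/
theorem finite_setOf_latticeGraphIso_antidiagonal_eq_of_coe_eq_conj_endoGL [Finite 𝓀[K]] {σ : K →+* K} (hvσ : ∀ a, Valued.v (σ a) = Valued.v a)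
    (h2 : Valued.v (2 : K) = 1) (hsq : ∀ u : K, Valued.v (u - 1) < 1 → IsSquare u) {ϖ : K} (hϖ : Valued.v ϖ = WithZero.exp (-1 : ℤ))
    {H₂ : Matrix (Fin 2) (Fin 2) K} (hH₂i : IsIntMatrix H₂) (hH₂d : Valued.v H₂.det = 1) {h : K} (hh : Valued.v h = 1)
    (γ₂ : GL (Fin 2) K) (hγ : IsIntMatrix (γ₂ : Matrix (Fin 2) (Fin 2) K)) (hirr : ∀ x : K, ¬ (γ₂ : Matrix (Fin 2) (Fin 2) K).charpoly.IsRoot x)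
    (u : GL (Fin 1) K) (hu : Valued.v ((u : Matrix (Fin 1) (Fin 1) K) 0 0) ≤ 1)
    (P : GL (Fin 3) K) {c : K} (hc : Valued.v c = 1)
    (hP : (!![H₂ 0 0, 0, H₂ 0 1; 0, h, 0; H₂ 1 0, 0, H₂ 1 1] : Matrix (Fin 3) (Fin 3) K) = c • formCongr σ P ((StdForm.antidiagonal 3).over K))
    (γ : unitaryGroupOfForm σ ((StdForm.antidiagonal 3).over K)) (hγP : (γ : GL (Fin 3) K) = P * endoGL (γ₂, u) * P⁻¹) :
    {v : {M : Submodule 𝒪[K] (Fin 3 → K) // IsVertex σ ϖ ((StdForm.antidiagonal 3).over K) M} |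
      latticeGraphIso σ ϖ ((StdForm.antidiagonal 3).over K) γ v = v}.Finite := by
  have hc0 : IsUnit c := isUnit_iff_ne_zero.2 (fun h0 => by rw [h0, map_zero] at hc; exact zero_ne_one hc)
  -- `endoGL(γ₂, u) ∈ U(σ, ι-shape(H₂, h))`
  have hmem : endoGL (γ₂, u) ∈ unitaryGroupOfForm σ (!![H₂ 0 0, 0, H₂ 0 1; 0, h, 0; H₂ 1 0, 0, H₂ 1 1] : Matrix (Fin 3) (Fin 3) K) := by
    rw [hP, unitaryGroupOfForm_smul_of_isUnit σ hc0, ← conj_mem_unitaryGroupOfForm_iff σ P _ (endoGL (γ₂, u)), ← hγP]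
    exact γ.2
  exact finite_setOf_latticeGraphIso_eq_of_model σ ϖ hc _ P hP γ ⟨endoGL (γ₂, u), hmem⟩ hγP
    (finite_setOf_latticeGraphIso_endoGL_eq_of_rootless hvσ h2 hsq hϖ hH₂i hH₂d hh γ₂ hγ hirr u hu ⟨endoGL (γ₂, u), hmem⟩ rfl)

end Literature.NumberTheory.Automorphic.UnitaryLatticeTree

end
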